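import Mathlib.RingTheory.Smooth.StandardSmooth
import Mathlib.RingTheory.Extension.Presentation.Submersive
import Mathlib.RingTheory.Localization.Away.Basic
import Mathlib.Algebra.MvPolynomial.PDeriv
import HarnessLib

/-!
# The Jacobian criterion for one equation: `(k[y₀,…,yₙ][1/∂ⱼf]) ⧸ (f)` is standard smooth

Let `k` be a commutative ring, `f ∈ k[y₀, …, yₙ]` and `j` an index, and let `S` be a localisation
of `k[y]` away from the partial derivative `∂f/∂yⱼ` (any `k[y]`-algebra with
`IsLocalization.Away (pderiv j f) S`). We prove that the quotient `S ⧸ (f)` is a standard smooth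
`k`-algebra of relative dimension `n` in the sense of Mathlib
(`Algebra.IsStandardSmoothOfRelativeDimension`): it has the presentation with `n + 2` generators
`t, y₀, …, yₙ` and the two relations `f(y) = 0`, `t · (∂f/∂yⱼ)(y) − 1 = 0`, whose Jacobian with
respect to `(yⱼ, t)` is `det [[∂ⱼf, t ∂ⱼ∂ⱼf], [0, ∂ⱼf]] = (∂ⱼf)²`, a unit. This is the affine
Jacobian criterion behind «a hypersurface `f = 0` is nonsingular at the points where some partial
derivative does not vanish» (Hartshorne, *Algebraic Geometry*, I §5, Definition p. 32 and Thm. 5.1;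
III §10, Thm. 10.2 / Prop. 10.4 for the equivalence of smoothness with the Jacobian condition).
It is the local model of the smooth hypersurfaces of `Motives/SmoothHypersurfaceExistence`.

## Main result

* `Literature.AlgebraicGeometry.Motives.SmoothHypersurface.isStandardSmoothOfRelativeDimension_quotient`:
  `Algebra.IsStandardSmoothOfRelativeDimension n k (S ⧸ Ideal.span {algebraMap k[y] S f})`.

## Proof

Mathlib presents `S` over `k` by composing the one-generator presentation of a localisation
(`Algebra.Presentation.localizationAway`, relation `t·g − 1`) with the tautological presentation of
the polynomial ring (`Algebra.Generators.mvPolynomial`, no relations); the kernel of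
`k[t, y] → S ⧸ (f)` is then `(f, t·g − 1)` by `Ideal.comap_map_of_surjective`, and the Jacobian is
computed with `Matrix.det_fin_two`.

## References

* R. Hartshorne, *Algebraic Geometry*, GTM 52 (1977): I §5 (p. 32, Jacobian matrix; Thm. 5.1),
  III §10 (Thm. 10.2, Prop. 10.4). [Hartshorne1977]
-/

noncomputable section

open MvPolynomial

universe u v

namespace Literature.AlgebraicGeometry.Motives.SmoothHypersurface

variable (k : Type u) [CommRing k] (n : ℕ)

/-- The tautological presentation of `k[y₀,…,yₙ]` over `k`: generators the variables, no
relations (Mathlib `Algebra.Generators.mvPolynomial`, whose kernel is `⊥`). [folklore] -/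
def polyPresentation :
    Algebra.Presentation k (MvPolynomial (Fin (n + 1)) k) (Fin (n + 1)) PEmpty.{1} where
  toGenerators := Algebra.Generators.mvPolynomial k (Fin (n + 1))
  relation := PEmpty.elim
  span_range_relation_eq_ker := by
    rw [Algebra.Generators.ker_mvPolynomial]
    simp

variable {k n}
variable (f : MvPolynomial (Fin (n + 1)) k) (j : Fin (n + 1))
  (S : Type v) [CommRing S] [Algebra k S] [Algebra (MvPolynomial (Fin (n + 1)) k) S]
  [IsScalarTower k (MvPolynomial (Fin (n + 1)) k) S] [IsLocalization.Away (pderiv j f) S]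

/-- Mathlib's presentation of the localisation `S = k[y][1/∂ⱼf]` over `k`: generators `t` (for
`1/∂ⱼf`) and `y₀,…,yₙ`, one relation `t·∂ⱼf − 1` (`Algebra.Presentation.localizationAway` composed
with `polyPresentation`). [folklore] -/
def locPresentation :
    Algebra.Presentation k S (Unit ⊕ Fin (n + 1)) (Unit ⊕ PEmpty.{1}) :=
  (Algebra.Presentation.localizationAway S (pderiv j f)).comp (polyPresentation k n)

/-- The values of the generators of `locPresentation`: `t ↦ 1/∂ⱼf`, `yᵢ ↦ yᵢ`. [folklore] -/
theorem locPresentation_val :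
    (locPresentation f j S).val =
      Sum.elim (fun _ : Unit => IsLocalization.Away.invSelf (S := S) (pderiv j f))
        (fun i => algebraMap (MvPolynomial (Fin (n + 1)) k) S (X i)) := by
  ext (u | i)
  · simp [locPresentation, Algebra.Presentation.comp, Algebra.Generators.comp_val,
      Algebra.Presentation.localizationAway]
  · simp [locPresentation, Algebra.Presentation.comp, Algebra.Generators.comp_val, polyPresentation]

/-- The single relation of `locPresentation` is `t·(∂ⱼf)(y) − 1` (Mathlib
`Algebra.Presentation.relation_comp_localizationAway_inl`). [folklore] -/
theorem locPresentation_relation_inl (u : Unit) :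
    (locPresentation f j S).relation (Sum.inl u) =
      rename Sum.inr (pderiv j f) * X (Sum.inl ()) - 1 := by
  simp [locPresentation, Algebra.Presentation.relation_comp_localizationAway_inl, polyPresentation]

/-- Evaluating at the generators of `locPresentation` after renaming `yᵢ ↦ yᵢ` is the structure map
`k[y] → S`. [folklore] -/
theorem aeval_locPresentation_val_rename (p : MvPolynomial (Fin (n + 1)) k) :
    aeval (locPresentation f j S).val (rename Sum.inr p) =
      algebraMap (MvPolynomial (Fin (n + 1)) k) S p := by
  rw [aeval_rename, locPresentation_val]
  have : aeval (R := k) ((Sum.elim (fun _ : Unit => IsLocalization.Away.invSelf (S := S) (pderiv j f))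
      (fun i => algebraMap (MvPolynomial (Fin (n + 1)) k) S (X i))) ∘ Sum.inr) =
      IsScalarTower.toAlgHom k (MvPolynomial (Fin (n + 1)) k) S := by
    refine MvPolynomial.algHom_ext fun i => ?_
    simp
  rw [this]
  rfl

/-- The quotient `S ⧸ (f)` of the localisation `S = k[y][1/∂ⱼf]`. -/
local notation "Q" => S ⧸ Ideal.span {algebraMap (MvPolynomial (Fin (n + 1)) k) S f}

/-- The two relations `f(y)` and `t·(∂ⱼf)(y) − 1` of the hypersurface chart, in `k[t, y₀,…,yₙ]`.
[folklore] -/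
def chartRelation : Fin 2 → MvPolynomial (Unit ⊕ Fin (n + 1)) k :=
  ![rename Sum.inr f, rename Sum.inr (pderiv j f) * X (Sum.inl ()) - 1]

/-- The generators `t, y₀, …, yₙ` of `S ⧸ (f)` over `k` (images of those of `locPresentation`).
[folklore] -/
def quotGenerators : Algebra.Generators k Q (Unit ⊕ Fin (n + 1)) :=
  Algebra.Generators.ofAlgHom
    ((Ideal.Quotient.mkₐ k _).comp (aeval (locPresentation f j S).val))
    ((Ideal.Quotient.mkₐ_surjective k _).comp (locPresentation f j S).aeval_val_surjective)

/-- Evaluation at the generators of `S ⧸ (f)` is evaluation at those of `S` followed by the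
quotient map. [folklore] -/
theorem aeval_quotGenerators_val (p : MvPolynomial (Unit ⊕ Fin (n + 1)) k) :
    aeval (quotGenerators f j S).val p =
      Ideal.Quotient.mk _ (aeval (locPresentation f j S).val p) := by
  have : aeval (R := k) (quotGenerators f j S).val =
      (Ideal.Quotient.mkₐ k _).comp (aeval (locPresentation f j S).val) := by
    refine MvPolynomial.algHom_ext fun i => ?_
    simp [quotGenerators, Algebra.Generators.ofAlgHom, Algebra.Generators.ofSurjective]
  rw [this]
  rfl

/-- The kernel of `k[t, y] → S ⧸ (f)` is generated by `f(y)` and `t·∂ⱼf(y) − 1`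
(`Ideal.comap_map_of_surjective` over the kernel `(t·∂ⱼf − 1)` of `k[t, y] → S`). [folklore] -/
theorem span_range_chartRelation :
    Ideal.span (Set.range (chartRelation f j)) = (quotGenerators f j S).ker := by
  rw [Algebra.Generators.ker_eq_ker_aeval_val]
  have hker : RingHom.ker (aeval (R := k) (quotGenerators f j S).val) =
      Ideal.comap (aeval (locPresentation f j S).val)
        (Ideal.span {algebraMap (MvPolynomial (Fin (n + 1)) k) S f}) := by
    ext p
    simp only [RingHom.mem_ker, Ideal.mem_comap, aeval_quotGenerators_val]
    exact Ideal.Quotient.eq_zero_iff_mem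
  rw [hker]
  have hmap : Ideal.span {algebraMap (MvPolynomial (Fin (n + 1)) k) S f} =
      Ideal.map (aeval (locPresentation f j S).val) (Ideal.span {rename Sum.inr f}) := by
    rw [Ideal.map_span, Set.image_singleton]
    simp [aeval_locPresentation_val_rename]
  rw [hmap, Ideal.comap_map_of_surjective _ (locPresentation f j S).aeval_val_surjective,
    ← RingHom.ker_eq_comap_bot]
  have hk : RingHom.ker (aeval (locPresentation f j S).val) =
      Ideal.span (Set.range (locPresentation f j S).relation) := by
    rw [(locPresentation f j S).span_range_relation_eq_ker,
      Algebra.Generators.ker_eq_ker_aeval_val]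
  rw [hk]
  have hrange : Set.range (locPresentation f j S).relation =
      {rename Sum.inr (pderiv j f) * X (Sum.inl ()) - 1} := by
    ext p
    simp only [Set.mem_range, Set.mem_singleton_iff]
    constructor
    · rintro ⟨(u | e), rfl⟩
      · exact locPresentation_relation_inl f j S u
      · exact e.elim
    · rintro rfl
      exact ⟨Sum.inl (), locPresentation_relation_inl f j S ()⟩
  rw [hrange, chartRelation, Matrix.range_cons, Matrix.range_cons, Matrix.range_empty,
    Set.union_empty, Set.union_comm, Set.singleton_union, Ideal.span_insert, sup_comm]

/-- The naive presentation of `S ⧸ (f)` over `k`: generators `t, y₀,…,yₙ`, relations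
`f(y)`, `t·∂ⱼf(y) − 1`, Jacobian taken with respect to `(yⱼ, t)`. [folklore] -/
def quotPresentation : Algebra.PreSubmersivePresentation k Q (Unit ⊕ Fin (n + 1)) (Fin 2) where
  toGenerators := quotGenerators f j S
  relation := chartRelation f j
  span_range_relation_eq_ker := span_range_chartRelation f j S
  map := ![Sum.inr j, Sum.inl ()]
  map_inj := by
    intro a b h
    fin_cases a <;> fin_cases b <;> simp_all

omit [IsLocalization.Away (pderiv j f) S] in
/-- A polynomial in the `y`-variables has zero derivative in `t`. [folklore] -/
theorem pderiv_inl_rename_inr (p : MvPolynomial (Fin (n + 1)) k) :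
    pderiv (Sum.inl ()) (rename (Sum.inr (α := Unit)) p) = 0 := by
  classical
  refine pderiv_eq_zero_of_notMem_vars fun h => ?_
  obtain ⟨i, -, hi⟩ := Finset.mem_image.mp (vars_rename _ _ h)
  exact Sum.inr_ne_inl hi

/-- The Jacobian matrix of `quotPresentation` has determinant `(∂ⱼf)²` (in `k[t, y]`). [folklore] -/
theorem jacobiMatrix_det_quotPresentation :
    (quotPresentation f j S).jacobiMatrix.det = rename Sum.inr (pderiv j f) ^ 2 := by
  have h00 : (quotPresentation f j S).jacobiMatrix 0 0 = rename Sum.inr (pderiv j f) := by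
    rw [Algebra.PreSubmersivePresentation.jacobiMatrix_apply]
    exact pderiv_rename Sum.inr_injective j f
  have h10 : (quotPresentation f j S).jacobiMatrix 1 0 = 0 := by
    rw [Algebra.PreSubmersivePresentation.jacobiMatrix_apply]
    exact pderiv_inl_rename_inr (k := k) f
  have h11 : (quotPresentation f j S).jacobiMatrix 1 1 = rename Sum.inr (pderiv j f) := by
    rw [Algebra.PreSubmersivePresentation.jacobiMatrix_apply]
    change pderiv (Sum.inl ()) (rename Sum.inr (pderiv j f) * X (Sum.inl ()) - 1) = _
    rw [map_sub, Derivation.leibniz, pderiv_inl_rename_inr, pderiv_X_self,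
      Derivation.map_one_eq_zero]
    simp
  rw [Matrix.det_fin_two, h00, h10, h11, mul_zero, sub_zero, sq]

omit [Algebra k S] [IsScalarTower k (MvPolynomial (Fin (n + 1)) k) S] in
/-- `∂ⱼf` is a unit in `S ⧸ (f)` (it is already a unit in `S = k[y][1/∂ⱼf]`). [folklore] -/
theorem isUnit_mk_pderiv :
    IsUnit (Ideal.Quotient.mk (Ideal.span {algebraMap (MvPolynomial (Fin (n + 1)) k) S f})
      (algebraMap (MvPolynomial (Fin (n + 1)) k) S (pderiv j f))) :=
  (IsLocalization.Away.algebraMap_isUnit (S := S) (pderiv j f)).map _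

include j in
/-- **Jacobian criterion, one equation**: `(k[y₀,…,yₙ][1/∂ⱼf]) ⧸ (f)` is a standard smooth
`k`-algebra of relative dimension `n` (presentation `k[t, y]/(f, t∂ⱼf − 1)` with Jacobian `(∂ⱼf)²`
a unit; `n + 2` generators, `2` relations). Hartshorne I §5 (Jacobian matrix, p. 32) with
III Thm. 10.2 / Prop. 10.4. [cite: Hartshorne1977, I §5 Definition p. 32 and III Prop. 10.4] -/
theorem isStandardSmoothOfRelativeDimension_quotient :
    Algebra.IsStandardSmoothOfRelativeDimension n k Q := by
  classical
  let P₀ := quotPresentation f j S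
  have hJ : IsUnit P₀.jacobian := by
    rw [P₀.jacobian_eq_jacobiMatrix_det]
    change IsUnit (algebraMap _ Q (quotPresentation f j S).jacobiMatrix.det)
    rw [jacobiMatrix_det_quotPresentation, map_pow]
    refine IsUnit.pow 2 ?_
    rw [Algebra.Generators.algebraMap_apply]
    change IsUnit (aeval (quotGenerators f j S).val (rename Sum.inr (pderiv j f)))
    rw [aeval_quotGenerators_val, aeval_locPresentation_val_rename]
    exact isUnit_mk_pderiv f j S
  let P : Algebra.SubmersivePresentation k Q (Unit ⊕ Fin (n + 1)) (Fin 2) :=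
    { toPreSubmersivePresentation := P₀, jacobian_isUnit := hJ }
  exact P.isStandardSmoothOfRelativeDimension (by simp [Algebra.Presentation.dimension]; omega)

end Literature.AlgebraicGeometry.Motives.SmoothHypersurface

end
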